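import Summits.QuantumFields.YangMills.Theorems.UnitScaleTiltProp7DirichletOfOffsetFamily
import Summits.QuantumFields.YangMills.Theorems.UnitScaleTiltProp7JunctionGroupOfOffsetFamily
import Summits.QuantumFields.YangMills.Theorems.UnitScaleTiltProp7RowHResOfHKgK
import HarnessLib

/-!
# Route `UnitScaleTilt`, crux K1 «MinimiserStabilityRegPr» (stmt-QuantumFields-19200), route-R E′, S3 K-form engine, ROW (H) — «ROWS-H-OF-OFFSET-FAMILY KNIT» (member level):
# the ∃-clause of ✓p680452's ∕ ✓p679008's hypothesis (`∃ Ψ Z, hΨ ∧ hRes ∧ hDir ∧ hGJ_pt`, free reals) INHABITED by the h-averaged offset-comb local models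
# `Ψ̄_y(z) = ℓ′⁻¹Σ_(h<ℓ′) R(axialT 𝒲 c^h_y z)⁻¹ R(𝒲([c_y,c^h_y])⁻¹)ψ(c_y)` and the recentring `Z_μ z := Ψ̄_(B(z))(z)`, FROM the displayed rows of ★p1 g16's NAMER WORD 15 (1):
# (i) hKg′-K(R4′-fam) `c_D·FAM ≤ ζ_D·K + θ_D·e·ℓ⁻²·M` (→ hDir by ✓p680787), (ii) hLap + hKg′(site) in ✓p680955's letters (→ hRes by w4 g7's door, hDir from (i), window `a² ≤ c_D`),
# (iii) hJunc `c_G·d·[✓p681065's RHS at the transports S] ≤ C_H·ℓ⁻¹·δV + ζ_G·K + θ_G·e·ℓ⁻²·M` (→ hGJ_pt by ✓p681065), (iv) hΨ by ✓ `offsetFamily_interp` averaged.  Window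
# `hN : (2ℓ + ℓ′)·2 < N` (members with `L^(m+n)` tiny need the separate small-torus branch, ★p1 WORD 15).

Cell `ym3-torus`, D-0154 (3c) twin-width seat `ym-routeR-w1` (gen 6); ★p1 g16 NAMER WORD 15 «routeR-w1 g6: ROWS-H-OF-OFFSET-FAMILY KNIT» (MINE 00:2xZ).  THEOREMS ONLY (0 `def`,
0 `sorry`); `--supports stmt-QuantumFields-19200`, count-neutral.  YM₃ on T³ is a ladder rung (R3), not the Clay problem; nothing here claims (H), S3, E′, a stub, the crux, d = 4
or the gap — rows (i)(ii)(iii) are DISPLAYED.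

WHAT IS PROVED (ns `…Theorems.Prop7RowsHOfOffsetFamily`): ★★★ `rowsH_of_offsetFamilyRows`.
HONEST SCOPE.  A knit of displayed rows over ✓p680787, ✓p681065, ✓p680955, ✓p671968; constants: `ζ_R := 6(A₁C_g′ + A₂ζ_D)`, `θ_R := 6(A₁θ_g′ + A₂θ_D)` (w4's), others pass through.

References: T. Bałaban, CMP 99 (1985) 389–434 [Balaban1985BackgroundPropagators] ((3.3)–(3.4) pp.390–391, (3.8) p.392, Thm 3.11 p.416); CMP 98 (1985) 17–51 [Balaban1985Averaging]
((9) p.18, (19)–(20) p.21); CMP 102 (1985) 255–275 [Balaban1985UV3] ((27) p.263); CMP 102 (1985) 277–309 [Balaban1985Variational] (Prop. 7 p.299).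
-/

set_option autoImplicit false

noncomputable section

open scoped BigOperators Matrix.Norms.L2Operator Matrix

namespace Summit.QuantumFields.YangMills.Theorems.Prop7RowsHOfOffsetFamily

open Literature.MathematicalPhysics.QuantumFieldTheory.Balaban1983to89
open Literature.MathematicalPhysics.QuantumFieldTheory.Balaban1983to89.T3ContinuumYM3Torus
open B7Prop1Explicit (Letter e seg treeWord hol)
open B9Eq39Adjoint (R covD covDstar divB)
open B9TorusCalculus (torusT)
open B10Eq27TorusAxialLog (unitsField toUField holT axialT contourT rel pull transl)
open B5Eq118OneStroke (iterBlockOf)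
open B15DeterminingSets (embIter)
open Summit.QuantumFields.YangMills.Theorems.Prop7AxialOffsetFamily (offsetFamily_interp)
open Summit.QuantumFields.YangMills.Theorems.Prop7DirichletOfOffsetFamily (dirichlet_offsetFamily_le_transported)
open Summit.QuantumFields.YangMills.Theorems.Prop7JunctionGroupOfOffsetFamily (junctionGroup_offsetFamily_le)
open Summit.QuantumFields.YangMills.Theorems.Prop7RowHResOfHKgK (rowHRes_of_hLap_hKgPrime_hDir)

/-- ★★★ **ROWS (H) OF THE OFFSET-COMB FAMILY** — `∃ Ψ Z, hΨ ∧ hRes ∧ hDir ∧ hGJ_pt` (✓p679008's letters, free reals) at `Ψ := Ψ̄^(offset)`, `Z := Ψ̄_(B(·))`, from the displayed rows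
hKg′-K(R4′-fam), hLap, hKg′(site), hJunc (see the module docstring). [cite: Balaban1985BackgroundPropagators, (3.3)-(3.4) pp.390-391, Thm 3.11 p.416]
[cite: Balaban1985Averaging, (9) p.18, (19)–(20) p.21] [cite: Balaban1985UV3, (27) p.263] -/
theorem rowsH_of_offsetFamilyRows (F : T3Family) (K n : ℕ) (hk : K - n ≤ (F.P K).m + (F.P K).K)
    (W : GaugeField (F.P K) 0 (Matrix.specialUnitaryGroup (Fin 2) ℂ)) (ψ : Site (F.P K) 0 → Matrix (Fin 2) (Fin 2) ℂ)
    (ι : Fin (F.P K).d) (ℓ' : ℕ) [NeZero ℓ'] (hN : (2 * (F.P K).L ^ (K - n) + ℓ') * 2 < (F.P K).sitesPerDir 0)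
    (s t : Fin (F.P K).d → List (Fin (F.P K).d)) (hsplit : ∀ μ, (List.finRange (F.P K).d).reverse = s μ ++ μ :: t μ) (hs : ∀ μ, μ ∉ s μ) (ht : ∀ μ, μ ∉ t μ)
    (S : Site (F.P K) (K - n) → Site (F.P K) 0 → (Matrix (Fin 2) (Fin 2) ℂ)ˣ)
    (hS : ∀ y z, ‖((S y z : (Matrix (Fin 2) (Fin 2) ℂ)ˣ) : Matrix (Fin 2) (Fin 2) ℂ)‖ ≤ 1 ∧ ‖(((S y z)⁻¹ : (Matrix (Fin 2) (Fin 2) ℂ)ˣ) : Matrix (Fin 2) (Fin 2) ℂ)‖ ≤ 1)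
    {Kr Mr δV ee C_H ζ_D θ_D ζ_G θ_G a A₁ A₂ KGP Cg' θg' : ℝ} (hA₁ : 0 ≤ A₁) (hA₂ : 0 ≤ A₂)
    (ha : a ^ 2 ≤ 2 * (3 * (2 * ((F.P K).d : ℝ) * (6 / ((((F.P K).L ^ (K - n) : ℕ) : ℝ)))) * (3 / ((((F.P K).L ^ (K - n) : ℕ) : ℝ)))))
    (hKgPfam : 2 * (3 * (2 * ((F.P K).d : ℝ) * (6 / ((((F.P K).L ^ (K - n) : ℕ) : ℝ)))) * (3 / ((((F.P K).L ^ (K - n) : ℕ) : ℝ))))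
          * (∑ y : Site (F.P K) (K - n), (ℓ' : ℝ)⁻¹ * ∑ η : Fin ℓ', (2 * ∑ μ : Fin (F.P K).d,
              ((((t μ).length * (2 * (F.P K).L ^ (K - n) + ℓ') : ℕ) : ℝ) * ∑ i ∈ Finset.range (t μ).length, (((2 * (2 * (F.P K).L ^ (K - n) + ℓ') + 1) ^ ((t μ).length - i) : ℕ) : ℝ)
                * ∑ q ∈ Fintype.piFinset (fun _ : Fin (F.P K).d => Finset.Icc (-((2 * (F.P K).L ^ (K - n) + ℓ') : ℤ)) ((2 * (F.P K).L ^ (K - n) + ℓ') : ℤ)),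
                    (‖R (holT (unitsField (toUField W)) (embIter (K - n) y) (seg ι ((η : ℕ) : ℤ) ++ treeWord q))
                          ((holT (unitsField (toUField W)) (transl (transl (embIter (K - n) y) (((η : ℕ) : ℤ) • e ι)) q) [((t μ).getD i μ, true), (μ, true), Letter.rev ((t μ).getD i μ, true), (μ, false)] : (Matrix (Fin 2) (Fin 2) ℂ)ˣ) : Matrix (Fin 2) (Fin 2) ℂ)
                        * ψ (embIter (K - n) y)
                      - ψ (embIter (K - n) y)
                        * R (holT (unitsField (toUField W)) (embIter (K - n) y) (seg ι ((η : ℕ) : ℤ) ++ treeWord q))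
                          ((holT (unitsField (toUField W)) (transl (transl (embIter (K - n) y) (((η : ℕ) : ℤ) • e ι)) q) [((t μ).getD i μ, true), (μ, true), Letter.rev ((t μ).getD i μ, true), (μ, false)] : (Matrix (Fin 2) (Fin 2) ℂ)ˣ) : Matrix (Fin 2) (Fin 2) ℂ)‖ ^ 2
                    + ‖R (holT (unitsField (toUField W)) (embIter (K - n) y) (seg ι ((η : ℕ) : ℤ) ++ treeWord q))
                          ((holT (unitsField (toUField W)) (transl (transl (embIter (K - n) y) (((η : ℕ) : ℤ) • e ι)) q) [((t μ).getD i μ, false), (μ, true), Letter.rev ((t μ).getD i μ, false), (μ, false)] : (Matrix (Fin 2) (Fin 2) ℂ)ˣ) : Matrix (Fin 2) (Fin 2) ℂ)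
                        * ψ (embIter (K - n) y)
                      - ψ (embIter (K - n) y)
                        * R (holT (unitsField (toUField W)) (embIter (K - n) y) (seg ι ((η : ℕ) : ℤ) ++ treeWord q))
                          ((holT (unitsField (toUField W)) (transl (transl (embIter (K - n) y) (((η : ℕ) : ℤ) • e ι)) q) [((t μ).getD i μ, false), (μ, true), Letter.rev ((t μ).getD i μ, false), (μ, false)] : (Matrix (Fin 2) (Fin 2) ℂ)ˣ) : Matrix (Fin 2) (Fin 2) ℂ)‖ ^ 2))))
        ≤ ζ_D * Kr + θ_D * ee * (((F.L : ℝ) ^ (K - n)) ^ 2)⁻¹ * Mr)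
    (hLap : (∑ y : Site (F.P K) (K - n), ∑ z : Site (F.P K) 0,
            (if (∀ ν : Fin (F.P K).d,
                (y ν = (iterBlockOf (K - n) (fun κ => z κ - (((((F.P K).L ^ (K - n) - 1) / 2 : ℕ)) : ZMod ((F.P K).sitesPerDir 0)))) ν - 1
                ∨ y ν = (iterBlockOf (K - n) (fun κ => z κ - (((((F.P K).L ^ (K - n) - 1) / 2 : ℕ)) : ZMod ((F.P K).sitesPerDir 0)))) ν
                ∨ y ν = (iterBlockOf (K - n) (fun κ => z κ - (((((F.P K).L ^ (K - n) - 1) / 2 : ℕ)) : ZMod ((F.P K).sitesPerDir 0)))) ν + 1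
                ∨ y ν = (iterBlockOf (K - n) (fun κ => z κ - (((((F.P K).L ^ (K - n) - 1) / 2 : ℕ)) : ZMod ((F.P K).sitesPerDir 0)))) ν + 2))
              then ‖divB (torusT (F.P K) 0) (fun κ z => unitsField (toUField W) ⟨z, κ⟩)
                (fun μ => covD (torusT (F.P K) 0) (fun κ z => unitsField (toUField W) ⟨z, κ⟩) μ (fun z => (ℓ' : ℝ)⁻¹ • ∑ η : Fin ℓ', R (axialT (unitsField (toUField W)) (transl (embIter (K - n) y) (((η : ℕ) : ℤ) • e ι)) z)⁻¹ (R (holT (unitsField (toUField W)) (embIter (K - n) y) (seg ι ((η : ℕ) : ℤ)))⁻¹ (ψ (embIter (K - n) y))))) z‖ ^ 2 else 0)) ≤ A₁ * KGP + A₂ * a ^ 2 * (∑ y : Site (F.P K) (K - n), ∑ z : Site (F.P K) 0,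
              (if (∀ ν : Fin (F.P K).d,
                  (y ν = (iterBlockOf (K - n) (fun κ => z κ - (((((F.P K).L ^ (K - n) - 1) / 2 : ℕ)) : ZMod ((F.P K).sitesPerDir 0)))) ν - 1
                  ∨ y ν = (iterBlockOf (K - n) (fun κ => z κ - (((((F.P K).L ^ (K - n) - 1) / 2 : ℕ)) : ZMod ((F.P K).sitesPerDir 0)))) ν
                  ∨ y ν = (iterBlockOf (K - n) (fun κ => z κ - (((((F.P K).L ^ (K - n) - 1) / 2 : ℕ)) : ZMod ((F.P K).sitesPerDir 0)))) ν + 1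
                  ∨ y ν = (iterBlockOf (K - n) (fun κ => z κ - (((((F.P K).L ^ (K - n) - 1) / 2 : ℕ)) : ZMod ((F.P K).sitesPerDir 0)))) ν + 2))
                then ∑ μ : Fin (F.P K).d,
                  (‖covDstar (torusT (F.P K) 0) (fun κ z => unitsField (toUField W) ⟨z, κ⟩) μ (fun z => (ℓ' : ℝ)⁻¹ • ∑ η : Fin ℓ', R (axialT (unitsField (toUField W)) (transl (embIter (K - n) y) (((η : ℕ) : ℤ) • e ι)) z)⁻¹ (R (holT (unitsField (toUField W)) (embIter (K - n) y) (seg ι ((η : ℕ) : ℤ)))⁻¹ (ψ (embIter (K - n) y)))) z‖ ^ 2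
                    + ‖covD (torusT (F.P K) 0) (fun κ z => unitsField (toUField W) ⟨z, κ⟩) μ (fun z => (ℓ' : ℝ)⁻¹ • ∑ η : Fin ℓ', R (axialT (unitsField (toUField W)) (transl (embIter (K - n) y) (((η : ℕ) : ℤ) • e ι)) z)⁻¹ (R (holT (unitsField (toUField W)) (embIter (K - n) y) (seg ι ((η : ℕ) : ℤ)))⁻¹ (ψ (embIter (K - n) y)))) z‖ ^ 2) else 0)))
    (hKgP : KGP ≤ Cg' * Kr + θg' * ee * (((F.L : ℝ) ^ (K - n)) ^ 2)⁻¹ * Mr)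
    (hJunc : 2 * (3 * (((F.P K).d : ℝ) * (24 / ((((F.P K).L ^ (K - n) : ℕ) : ℝ)) ^ 2) ^ 2))
          * (((F.P K).d : ℝ) * ∑ y : Site (F.P K) (K - n), ∑ z : Site (F.P K) 0,
      (if (∀ ν : Fin (F.P K).d,
          (y ν = (iterBlockOf (K - n) (fun κ => z κ - (((((F.P K).L ^ (K - n) - 1) / 2 : ℕ)) : ZMod ((F.P K).sitesPerDir 0)))) ν - 1
          ∨ y ν = (iterBlockOf (K - n) (fun κ => z κ - (((((F.P K).L ^ (K - n) - 1) / 2 : ℕ)) : ZMod ((F.P K).sitesPerDir 0)))) ν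
          ∨ y ν = (iterBlockOf (K - n) (fun κ => z κ - (((((F.P K).L ^ (K - n) - 1) / 2 : ℕ)) : ZMod ((F.P K).sitesPerDir 0)))) ν + 1
          ∨ y ν = (iterBlockOf (K - n) (fun κ => z κ - (((((F.P K).L ^ (K - n) - 1) / 2 : ℕ)) : ZMod ((F.P K).sitesPerDir 0)))) ν + 2))
        then (ℓ' : ℝ)⁻¹ * ∑ η : Fin ℓ', 2 * (‖R (S y z) (ψ (embIter (K - n) y)) - ψ (embIter (K - n) (iterBlockOf (K - n) (fun κ => z κ - (((((F.P K).L ^ (K - n) - 1) / 2 : ℕ)) : ZMod ((F.P K).sitesPerDir 0)))))‖ ^ 2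
            + ‖(((S y z)⁻¹ * holT (unitsField (toUField W)) (embIter (K - n) (iterBlockOf (K - n) (fun κ => z κ - (((((F.P K).L ^ (K - n) - 1) / 2 : ℕ)) : ZMod ((F.P K).sitesPerDir 0))))) (seg ι ((η : ℕ) : ℤ) ++ treeWord (rel (transl (embIter (K - n) (iterBlockOf (K - n) (fun κ => z κ - (((((F.P K).L ^ (K - n) - 1) / 2 : ℕ)) : ZMod ((F.P K).sitesPerDir 0))))) (((η : ℕ) : ℤ) • e ι)) z)) * (holT (unitsField (toUField W)) (embIter (K - n) y) (seg ι ((η : ℕ) : ℤ) ++ treeWord (rel (transl (embIter (K - n) y) (((η : ℕ) : ℤ) • e ι)) z)))⁻¹ : (Matrix (Fin 2) (Fin 2) ℂ)ˣ) : Matrix (Fin 2) (Fin 2) ℂ) * ψ (embIter (K - n) y)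
                - ψ (embIter (K - n) y) * (((S y z)⁻¹ * holT (unitsField (toUField W)) (embIter (K - n) (iterBlockOf (K - n) (fun κ => z κ - (((((F.P K).L ^ (K - n) - 1) / 2 : ℕ)) : ZMod ((F.P K).sitesPerDir 0))))) (seg ι ((η : ℕ) : ℤ) ++ treeWord (rel (transl (embIter (K - n) (iterBlockOf (K - n) (fun κ => z κ - (((((F.P K).L ^ (K - n) - 1) / 2 : ℕ)) : ZMod ((F.P K).sitesPerDir 0))))) (((η : ℕ) : ℤ) • e ι)) z)) * (holT (unitsField (toUField W)) (embIter (K - n) y) (seg ι ((η : ℕ) : ℤ) ++ treeWord (rel (transl (embIter (K - n) y) (((η : ℕ) : ℤ) • e ι)) z)))⁻¹ : (Matrix (Fin 2) (Fin 2) ℂ)ˣ) : Matrix (Fin 2) (Fin 2) ℂ)‖ ^ 2) else 0))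
        ≤ C_H * ((F.L : ℝ) ^ (K - n))⁻¹ * δV + ζ_G * Kr + θ_G * ee * (((F.L : ℝ) ^ (K - n)) ^ 2)⁻¹ * Mr)
    :
    ∃ (Ψ : Site (F.P K) (K - n) → Site (F.P K) 0 → Matrix (Fin 2) (Fin 2) ℂ)
        (Z : Fin (F.P K).d → Site (F.P K) 0 → Matrix (Fin 2) (Fin 2) ℂ),
      (∀ y, Ψ y (embIter (K - n) y) = ψ (embIter (K - n) y)) ∧
      -- hRes: the Laplacian group of the local models
      6 * (∑ y : Site (F.P K) (K - n), ∑ z : Site (F.P K) 0,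
            (if (∀ ν : Fin (F.P K).d,
                (y ν = (iterBlockOf (K - n) (fun κ => z κ - (((((F.P K).L ^ (K - n) - 1) / 2 : ℕ)) : ZMod ((F.P K).sitesPerDir 0)))) ν - 1
                ∨ y ν = (iterBlockOf (K - n) (fun κ => z κ - (((((F.P K).L ^ (K - n) - 1) / 2 : ℕ)) : ZMod ((F.P K).sitesPerDir 0)))) ν
                ∨ y ν = (iterBlockOf (K - n) (fun κ => z κ - (((((F.P K).L ^ (K - n) - 1) / 2 : ℕ)) : ZMod ((F.P K).sitesPerDir 0)))) ν + 1
                ∨ y ν = (iterBlockOf (K - n) (fun κ => z κ - (((((F.P K).L ^ (K - n) - 1) / 2 : ℕ)) : ZMod ((F.P K).sitesPerDir 0)))) ν + 2))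
              then ‖divB (torusT (F.P K) 0) (fun κ z => unitsField (toUField W) ⟨z, κ⟩)
                (fun μ => covD (torusT (F.P K) 0) (fun κ z => unitsField (toUField W) ⟨z, κ⟩) μ (Ψ y)) z‖ ^ 2 else 0))
        ≤ (6 * (A₁ * Cg' + A₂ * ζ_D)) * Kr + (6 * (A₁ * θg' + A₂ * θ_D)) * ee * (((F.L : ℝ) ^ (K - n)) ^ 2)⁻¹ * Mr ∧
      -- hDir: the supported covariant Dirichlet group of the local models
      2 * (3 * (2 * ((F.P K).d : ℝ) * (6 / ((((F.P K).L ^ (K - n) : ℕ) : ℝ)))) * (3 / ((((F.P K).L ^ (K - n) : ℕ) : ℝ))))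
          * (∑ y : Site (F.P K) (K - n), ∑ z : Site (F.P K) 0,
              (if (∀ ν : Fin (F.P K).d,
                  (y ν = (iterBlockOf (K - n) (fun κ => z κ - (((((F.P K).L ^ (K - n) - 1) / 2 : ℕ)) : ZMod ((F.P K).sitesPerDir 0)))) ν - 1
                  ∨ y ν = (iterBlockOf (K - n) (fun κ => z κ - (((((F.P K).L ^ (K - n) - 1) / 2 : ℕ)) : ZMod ((F.P K).sitesPerDir 0)))) ν
                  ∨ y ν = (iterBlockOf (K - n) (fun κ => z κ - (((((F.P K).L ^ (K - n) - 1) / 2 : ℕ)) : ZMod ((F.P K).sitesPerDir 0)))) ν + 1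
                  ∨ y ν = (iterBlockOf (K - n) (fun κ => z κ - (((((F.P K).L ^ (K - n) - 1) / 2 : ℕ)) : ZMod ((F.P K).sitesPerDir 0)))) ν + 2))
                then ∑ μ : Fin (F.P K).d,
                  (‖covDstar (torusT (F.P K) 0) (fun κ z => unitsField (toUField W) ⟨z, κ⟩) μ (Ψ y) z‖ ^ 2
                    + ‖covD (torusT (F.P K) 0) (fun κ z => unitsField (toUField W) ⟨z, κ⟩) μ (Ψ y) z‖ ^ 2) else 0))
        ≤ ζ_D * Kr + θ_D * ee * (((F.L : ℝ) ^ (K - n)) ^ 2)⁻¹ * Mr ∧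
      -- hGJ_pt: the POINTWISE interpolation-consistency group, booked against `δV` (the junction) and the currencies
      2 * (3 * (((F.P K).d : ℝ) * (24 / ((((F.P K).L ^ (K - n) : ℕ) : ℝ)) ^ 2) ^ 2))
          * (∑ y : Site (F.P K) (K - n), ∑ z : Site (F.P K) 0,
              (if (∀ ν : Fin (F.P K).d,
                  (y ν = (iterBlockOf (K - n) (fun κ => z κ - (((((F.P K).L ^ (K - n) - 1) / 2 : ℕ)) : ZMod ((F.P K).sitesPerDir 0)))) ν - 1
                  ∨ y ν = (iterBlockOf (K - n) (fun κ => z κ - (((((F.P K).L ^ (K - n) - 1) / 2 : ℕ)) : ZMod ((F.P K).sitesPerDir 0)))) ν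
                  ∨ y ν = (iterBlockOf (K - n) (fun κ => z κ - (((((F.P K).L ^ (K - n) - 1) / 2 : ℕ)) : ZMod ((F.P K).sitesPerDir 0)))) ν + 1
                  ∨ y ν = (iterBlockOf (K - n) (fun κ => z κ - (((((F.P K).L ^ (K - n) - 1) / 2 : ℕ)) : ZMod ((F.P K).sitesPerDir 0)))) ν + 2))
                then ∑ μ : Fin (F.P K).d, ‖Ψ y z - Z μ z‖ ^ 2 else 0))
        ≤ C_H * ((F.L : ℝ) ^ (K - n))⁻¹ * δV + ζ_G * Kr + θ_G * ee * (((F.L : ℝ) ^ (K - n)) ^ 2)⁻¹ * Mr := by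
  classical
  have hwin' : ∀ η : Fin ℓ', (((η : ℕ) : ℤ)).natAbs * 2 < (F.P K).sitesPerDir 0 := fun η => by
    rw [Int.natAbs_natCast]; have := η.isLt; omega
  have hcD : (0 : ℝ) ≤ 2 * (3 * (2 * ((F.P K).d : ℝ) * (6 / ((((F.P K).L ^ (K - n) : ℕ) : ℝ)))) * (3 / ((((F.P K).L ^ (K - n) : ℕ) : ℝ)))) := by positivity
  have hcG : (0 : ℝ) ≤ 2 * (3 * (((F.P K).d : ℝ) * (24 / ((((F.P K).L ^ (K - n) : ℕ) : ℝ)) ^ 2) ^ 2)) := by positivity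
  have hDir := (mul_le_mul_of_nonneg_left (dirichlet_offsetFamily_le_transported F K n hk W ψ ι ℓ' hN s t hsplit hs ht) hcD).trans hKgPfam
  have hGJ := (mul_le_mul_of_nonneg_left (junctionGroup_offsetFamily_le F K n W ψ ι ℓ' S hS) hcG).trans hJunc
  have hRes := rowHRes_of_hLap_hKgPrime_hDir F K n W
    (fun y z => (ℓ' : ℝ)⁻¹ • ∑ η : Fin ℓ', R (axialT (unitsField (toUField W)) (transl (embIter (K - n) y) (((η : ℕ) : ℤ) • e ι)) z)⁻¹ (R (holT (unitsField (toUField W)) (embIter (K - n) y) (seg ι ((η : ℕ) : ℤ)))⁻¹ (ψ (embIter (K - n) y)))) hA₁ hA₂ ha hLap hKgP hDir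
  refine ⟨fun y z => (ℓ' : ℝ)⁻¹ • ∑ η : Fin ℓ', R (axialT (unitsField (toUField W)) (transl (embIter (K - n) y) (((η : ℕ) : ℤ) • e ι)) z)⁻¹ (R (holT (unitsField (toUField W)) (embIter (K - n) y) (seg ι ((η : ℕ) : ℤ)))⁻¹ (ψ (embIter (K - n) y))),
    fun _μ z => (ℓ' : ℝ)⁻¹ • ∑ η : Fin ℓ', R (axialT (unitsField (toUField W)) (transl (embIter (K - n) (iterBlockOf (K - n) (fun κ => z κ - (((((F.P K).L ^ (K - n) - 1) / 2 : ℕ)) : ZMod ((F.P K).sitesPerDir 0))))) (((η : ℕ) : ℤ) • e ι)) z)⁻¹ (R (holT (unitsField (toUField W)) (embIter (K - n) (iterBlockOf (K - n) (fun κ => z κ - (((((F.P K).L ^ (K - n) - 1) / 2 : ℕ)) : ZMod ((F.P K).sitesPerDir 0))))) (seg ι ((η : ℕ) : ℤ)))⁻¹ (ψ (embIter (K - n) (iterBlockOf (K - n) (fun κ => z κ - (((((F.P K).L ^ (K - n) - 1) / 2 : ℕ)) : ZMod ((F.P K).sitesPerDir 0))))))), ?_, hRes, hDir, hGJ⟩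
  intro y
  have hc : ((ℓ' : ℕ) : ℝ) ≠ 0 := by exact_mod_cast (NeZero.ne ℓ')
  show (ℓ' : ℝ)⁻¹ • ∑ η : Fin ℓ', R (axialT (unitsField (toUField W)) (transl (embIter (K - n) y) (((η : ℕ) : ℤ) • e ι)) (embIter (K - n) y))⁻¹
      (R (holT (unitsField (toUField W)) (embIter (K - n) y) (seg ι ((η : ℕ) : ℤ)))⁻¹ (ψ (embIter (K - n) y))) = ψ (embIter (K - n) y)
  rw [Finset.sum_congr rfl fun η _ => offsetFamily_interp (unitsField (toUField W)) (embIter (K - n) y) ι _ (hwin' η) (ψ (embIter (K - n) y)),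
    Finset.sum_const, Finset.card_univ, Fintype.card_fin, ← Nat.cast_smul_eq_nsmul ℝ, smul_smul, inv_mul_cancel₀ hc, one_smul]

end Summit.QuantumFields.YangMills.Theorems.Prop7RowsHOfOffsetFamily

end
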